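/-
Copyright: cell `pub-ymgap` (HUMAN RULING D-0062), Track A of `YM-PLAN.md`, DAG node N20 (= NE7b); R134 seat `pub-ymgap-dag-n20-d`
(strategy s3 «alternative currency», generation 13), module 16.  Released under the licence of the surrounding project.
-/
import Summits.QuantumFields.YangMills.Theorems.BalabanUVNodesN20ByValueMultiscaleWall
import HarnessLib

/-!
# YM-DAG node N20 (= NE7b), strategy s3, THE FOURTH CURRENCY «BY VALUE» (module 16): THE IN-REGIME OBSTRUCTION TO (SF) IS JENSEN + THE RUNNING
# COUPLING; THE REPAIRED MOMENT DISPLAY (SF_w) TILTS EACH LEVEL IN UNITS OF ITS OWN COUPLING AND DELIVERS PRINT's RATE SHAPE `e^{−a₀ p₀(g_k)}`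

Track A of `YM-PLAN.md` (cell `pub-ymgap`, HUMAN RULING D-0062), node **N20** = spine estimate NE7b (`T4WeightBudget.RelWeightBound` — the cell
`pub-balaban`'s OWN estimate, NOT PRINTED in [Bałaban 1983–89], NOT PROVED).  Seat `pub-ymgap-dag-n20-d` (R134, s3), generation 13, module 16; it reads WITH
module 15 `…N20ByValueMultiscaleWall` (p517672) and its v1.1 erratum (p538088).  Kernel theorems only: 0 `def`, 0 `sorry`, standard axioms; COUNT-NEUTRAL
(`--supports` K3⁶, stmt-QuantumFields-20509, `--as helper`).  Restate-immune (fresh namespace; nothing of another seat re-declared).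

THE POINT.  Module 15 displayed, as the by-value wall of NE7b in MOMENT language, the scale-factorised joint moment
  (SF)  `∫ exp(β·Σ_{k≤K} t_k·Σ_{p∈Y_k}(1 − reTr Ū^k(∂p))) dμ_β ≤ exp(c_V·Σ_{k≤K} t_k·#Y_k)`   (all `Y`, all `0 ≤ t_k ≤ a₀`; `β = g₀⁻²` the BARE coupling),
and its v1.1 erratum showed (SF) over-strong in shape by over-tilting a smooth configuration — an obstruction the erratum itself places OUTSIDE the regime
(fixed lattice, `β → ∞`; threshold `β ≍ #bonds`).  This file records the obstruction that lives INSIDE the regime and the repair it dictates.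
(a) JENSEN (§1, typed).  (SF) at ONE pinned plaquette of level `k` with tilt `a₀ > 0` gives `β·⟨1 − reTr Ū^k(∂p)⟩_β ≤ c_V` for EVERY `k ≤ K`
  (★ `meanEnergy_le_of_scaleFactorised`): a `K`-uniform, coupling-free `c_V` asserts MEAN FLATNESS `⟨1 − reTr Ū^k(∂p)⟩_β ≤ c_V·g₀²` of Bałaban's block field
  at EVERY scale up to the unit lattice `T^{(K)}`.  Print's own calibration — the small-field thresholds `ε_k = g_k·p₀(g_k)`, `p₀(g) = A₀(log g⁻²)^{p₀}` of
  [Balaban1988Convergent] (1.1)∕(1.4) p. 246, (2.4) p. 255 (the tree's `Setup.p0Profile` ∕ `epsK`, def-R's `epsOfRecord`), one loop — has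
  `⟨1 − reTr Ū^k(∂p)⟩ ≍ g_k²` (the running coupling at scale `L^k`), so (SF) needs `c_V ≳ β·g_k² = g_k²∕g₀²`, and at the top
  of the tower `g_K²∕g₀² = g²·g₀(K)⁻² ≈ 1 + 2b₀g²·K·log L ↑ ∞` with the number of steps (`g = g_K` the fixed renormalised coupling, `g₀(K) → 0`): there is
  NO `K`-uniform `c_V` in the regime `β = g₀⁻² ≍ K log L` — modulo the expected non-flatness of the unit-scale block field (an unconditional (SF) along the
  regime would be a TRIVIALITY statement `⟨1 − reTr Ū^K(∂p)⟩_{g₀(K)⁻²} = O(g₀(K)²) → 0`, which is why no supplier can be expected to produce it).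
(b) THE REPAIR IS A WEIGHT PROFILE (§2–§3, typed as implications).  Tilt the level-`k` energy in units of ITS coupling: with a profile `w : ℕ → ℝ`, `0 ≤ w_k`
  (in the application `w_k = g₀²∕g_k² = (β·g_k²)⁻¹ ∈ (0, 1]`, so that `β·w_k = g_k⁻²`),
  (SF_w)  `∫ exp(β·Σ_{k≤K} s_k·w_k·Σ_{p∈Y_k}(1 − reTr Ū^k(∂p))) dμ_β ≤ exp(c_V·Σ_{k≤K} s_k·#Y_k)`   for all `Y` and all `0 ≤ s_k ≤ a₀`.
  ★ `weightFactorised_of_scaleFactorised`: (SF) ⇒ (SF_w) whenever `w ≤ 1`, `c_V ≥ 0` — the repair is a genuine WEAKENING.  (SF_w) passes the Jensen test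
  (★ `meanEnergy_le_of_weightFactorised`: `β·w_k·⟨1 − reTr Ū^k(∂p)⟩ ≤ c_V`, i.e. `⟨·⟩ ≤ c_V·g_k²` ✓ consistent with the calibration) and is not over-tilted
  in the regime (a lump of action `S = O(1)` smooth over `j ≥ 1∕a₀` levels gains at most `a₀·Σ_{k≤j} g_k⁻²·S = O(j·β)` against its own region letter
  `c_V·a₀·Σ_{k≤j} 6L^{4(j−k)} ≍ 6c_V a₀·L^{4j} ≫ j·β` as long as `K·log L ≪ L^{4∕a₀}`; module 15's fixed-lattice point (2) applies to (SF_w) verbatim and stays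
  outside the regime).  Markov (module 15 §1's device at `t_k = a₀·w_k`) then gives
  ★★★ `gibbsMeasure_multiLevel_largeField_le_prod_of_weightFactorised`: `μ_β{∀ k ≤ K, ∀ p ∈ Y_k: ε_k ≤ 1 − reTr Ū^k(∂p)} ≤ Π_k (e^{c_V a₀}·e^{−a₀·(β w_k)·ε_k})^{#Y_k}`
  — ONE Peierls factor `e^{c_V a₀}·e^{−a₀ g_k⁻² ε_k}` per pinned plaquette; at the record's thresholds (energy `ε_k = g_k²·p₀(g_k)²∕(2N B²)`, size `g_k p₀(g_k)∕B`)
  this is `e^{c_V a₀}·e^{−a₀·p₀(g_k)²∕(2N B²)}`: PRINT's RATE SHAPE «`exp(−p₀(g_k))`» ([Balaban1989LargeFieldII] (1.79)–(1.89) pp. 383–387), uniform in SHAPE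
  along the tower and `< 1` uniformly on a run with couplings `≤ γ` (the bookkeeping of n20-c's module 47 `…N20LCSPeierlsRegime`, `rate_le_exp_neg_profile`,
  cited, not used).  ★★ `…_dist1_…`, ★★★ `gibbsMeasure_multiLevel_largeFieldCells_le_prod_of_weightFactorised` ((MSP) ⇐ (SF_w), cells), and on Bałaban's
  label tower ★★★ `sum_admS_integral_le_labelTower_prod_of_weightFactorised` (module 15 §3 with the profile: factors
  `m_j·e^{c_V a₀}·e^{−a₀·(g₀⁻² w_{j+1})·ε_j²∕(2N)}` per pinned cube).
CORRECTED READING OF THE MOMENT-LANGUAGE WALL (supersedes module 15's (SF) as a socket; consistent with its erratum (3)): (SF_w) with `w_k = g₀²∕g_k²` =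
«the `k`-th block field `Ū^k` has the exponential plaquette moments of a lattice gauge field at coupling `g_k`, jointly in `k` with one budget per level» —
print's KIND (1.79); NOT in the tree, NOT printed as a statement, NOT proved here; (MSP) ⇐ (SF_w) by §2.  Module 12's `jointExpMoment_levels` remains the only
PROVED joint moment (one summable budget, bare units).

HONEST FRAMING.  Count-neutral kernel theorems: one Jensen device, two bookkeeping identities, three mean-energy corollaries, one weakening, four IMPLICATIONS displaying ONE hypothesis
on the bare state; nothing level-uniform is proved; the sizes `⟨1 − reTr Ū^k⟩ ≍ g_k²` and `g_K²∕g₀² ↑ ∞` quoted in (a) are one-loop ∕ calibration facts of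
print, NOT tree theorems.  Nothing of Bałaban's is asserted; NE7b NOT PRINTED ∕ NOT PROVED; the (α)-instance 0∕1; N20 NOT discharged (typed 28∕28, discharged
count untouched); one finite four-torus programme at fixed `ε` — NOT ℝ⁴, NOT infinite volume, NOT OS, NOT a mass gap, NOT Clay.  Residual binders of §3 as in
modules 9–15.  References (LOCATORS only; no decl carries a cite tag): T. Bałaban, CMP **119** (1988) 243–285 [Balaban1988Convergent] ((1.1), (1.4)
p. 246; (2.4) p. 255); CMP **122** (1989) 355–392 [Balaban1989LargeFieldII] ((1.79)–(1.89) pp. 383–387); Mathlib `ConvexOn.map_integral_le` (Jensen).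
-/

set_option autoImplicit false

noncomputable section

open scoped BigOperators

namespace Summit.QuantumFields.YangMills.BalabanUVNodes.N20ByValueMultiscaleWallRunning

open MeasureTheory
open Literature.MathematicalPhysics.QuantumFieldTheory.Balaban1983to89
open Literature.MathematicalPhysics.QuantumFieldTheory.Balaban1983to89.T4Continuum
open Literature.MathematicalPhysics.QuantumFieldTheory.Balaban1983to89.Node00
open Summit.QuantumFields.BalabanUV.T4Continuum.B16HistoryReprChain
open Summit.QuantumFields.BalabanUV.T4Continuum.NE7b.PrefixExtraction (admS)
open Summit.QuantumFields.BalabanUV.T4Continuum.ShellMeasureAverageIterate (iterMap)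
open Summit.QuantumFields.YangMills.BalabanUVNodes.N20LCSLabelTower
open Summit.QuantumFields.YangMills.BalabanUVNodes.N20LCSAvgExpMoment (sq_div_le_one_sub_reTr_of_le_dist1)
open Summit.QuantumFields.YangMills.BalabanUVNodes.N20ByValueLadder (measurable_iterBlockAvg)
open Summit.QuantumFields.YangMills.BalabanUVNodes.N20ByValueMultiscaleWall
  (measureReal_multiLevel_largeField_le_of_moment measureReal_largeFieldCells_le_of_levels)
open Summit.QuantumFields.YangMills.BalabanUVNodes.N20ByValueLabelTowerPinned
  (sum_admS_integral_labelTower_le_gibbsReal_mul iterMap_avOfRecord_eq)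

/-! ## §1 The Jensen reading: any exponential plaquette moment bounds the MEAN plaquette energy -/

section Jensen

variable {N : ℕ} [NeZero N]

/-- JENSEN DEVICE.  Under a probability measure, a measurable `f` with values in `[a, b]` and ANY real `c`: `∫ e^{c·f} ≤ e^{B}` forces `c·∫ f ≤ B`
(`exp` convex: `e^{c ∫f} ≤ ∫ e^{cf}`). [folklore] -/
theorem mul_integral_le_of_integral_exp_mul_le {Ω : Type*} [MeasurableSpace Ω] (μ : Measure Ω) [IsProbabilityMeasure μ] {f : Ω → ℝ}
    (hf : Measurable f) {a b : ℝ} (hfb : ∀ x, f x ∈ Set.Icc a b) (c : ℝ) {B : ℝ}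
    (hB : ∫ x, Real.exp (c * f x) ∂μ ≤ Real.exp B) : c * ∫ x, f x ∂μ ≤ B := by
  have hfi : Integrable f μ := Integrable.of_mem_Icc a b hf.aemeasurable (ae_of_all _ hfb)
  have hexp : Integrable (fun x => Real.exp (c * f x)) μ := by
    refine Integrable.of_mem_Icc (Real.exp (-(|c| * max |a| |b|))) (Real.exp (|c| * max |a| |b|))
      (Real.measurable_exp.comp (hf.const_mul c)).aemeasurable (ae_of_all _ fun x => ?_)
    have hcf : |c * f x| ≤ |c| * max |a| |b| := by
      rw [abs_mul]
      exact mul_le_mul_of_nonneg_left (abs_le_max_abs_abs (hfb x).1 (hfb x).2) (abs_nonneg c)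
    exact ⟨Real.exp_le_exp.2 (abs_le.mp hcf).1, Real.exp_le_exp.2 (abs_le.mp hcf).2⟩
  have hJ : Real.exp (∫ x, c * f x ∂μ) ≤ ∫ x, Real.exp (c * f x) ∂μ :=
    ConvexOn.map_integral_le (f := fun x => c * f x) convexOn_exp Real.continuous_exp.continuousOn isClosed_univ
      (Filter.Eventually.of_forall fun _ => Set.mem_univ _) (hfi.const_mul c) hexp
  rw [integral_const_mul] at hJ
  exact Real.exp_le_exp.1 (hJ.trans hB)

/-- ★ **MEAN PLAQUETTE ENERGY OF THE `k`-FOLD BLOCK FIELD FROM ANY SINGLE-PLAQUETTE EXPONENTIAL MOMENT.**  For `β ≥ 0`, a level-`k` plaquette `p` and ANY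
tilt `c` (e.g. `c = β·t`): `∫ e^{c·(1 − reTr Ū^k(∂p))} dμ_β ≤ e^{B}` forces `c·∫ (1 − reTr Ū^k(∂p)) dμ_β ≤ B`. [folklore] -/
theorem meanEnergy_le_of_levelMoment (P : Params) {β : ℝ} (hβ : 0 ≤ β) (k : ℕ) (p : Plaq P k) (c : ℝ) {B : ℝ}
    (hB : ∫ U, Real.exp (c * (1 - reTr (GaugeField.plaqHol
        (Averaging.iter (fun _ => BlockAveraging.blockAvg (ExpMeanLog.expMeanLogSU (n := Fin N))) k U) p)))
        ∂(T4GenFunBounds.gibbsMeasure P β : Measure (GaugeField P 0 (Matrix.specialUnitaryGroup (Fin N) ℂ))) ≤ Real.exp B) :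
    c * ∫ U, (1 - reTr (GaugeField.plaqHol
        (Averaging.iter (fun _ => BlockAveraging.blockAvg (ExpMeanLog.expMeanLogSU (n := Fin N))) k U) p))
        ∂(T4GenFunBounds.gibbsMeasure P β : Measure (GaugeField P 0 (Matrix.specialUnitaryGroup (Fin N) ℂ))) ≤ B := by
  haveI := T4GenFunBounds.isProbabilityMeasure_gibbsMeasure (G := Matrix.specialUnitaryGroup (Fin N) ℂ) P hβ
  refine mul_integral_le_of_integral_exp_mul_le _ ?_ (fun U => RegularGaugeGroup.one_sub_reTr_mem_Icc _) c hB
  exact measurable_const.sub (RegularGaugeGroup.measurable_reTr.comp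
    ((Missing.measurable_plaqHol p).comp (measurable_iterBlockAvg P k)))

/-- The multiscale tilt functional of a family pinning ONE plaquette `p` at level `k ≤ K` (`Y = update (fun _ ↦ ∅) k {p}`) is `t_k·(1 − reTr Ū^k(∂p))`.
[folklore] -/
theorem levelsTilt_update_single (P : Params) {K k : ℕ} (hk : k ≤ K) (p : Plaq P k) (t : ℕ → ℝ)
    (U : GaugeField P 0 (Matrix.specialUnitaryGroup (Fin N) ℂ)) :
    ∑ j ∈ Finset.range (K + 1), t j * ∑ q ∈ Function.update (fun j : ℕ => (∅ : Finset (Plaq P j))) k ({p} : Finset (Plaq P k)) j,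
        (1 - reTr (GaugeField.plaqHol
          (Averaging.iter (fun _ => BlockAveraging.blockAvg (ExpMeanLog.expMeanLogSU (n := Fin N))) j U) q)) =
      t k * (1 - reTr (GaugeField.plaqHol
          (Averaging.iter (fun _ => BlockAveraging.blockAvg (ExpMeanLog.expMeanLogSU (n := Fin N))) k U) p)) := by
  rw [Finset.sum_eq_single_of_mem k (Finset.mem_range.2 (Nat.lt_succ_of_le hk)) fun j _ hj => by
    rw [Function.update_of_ne hj, Finset.sum_empty, mul_zero]]
  rw [Function.update_self, Finset.sum_singleton]

/-- … and its cardinality functional is `t_k`. [folklore] -/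
theorem card_update_single (P : Params) {K k : ℕ} (hk : k ≤ K) (p : Plaq P k) (t : ℕ → ℝ) :
    ∑ j ∈ Finset.range (K + 1), t j * ((Function.update (fun j : ℕ => (∅ : Finset (Plaq P j))) k ({p} : Finset (Plaq P k)) j).card : ℝ) =
      t k := by
  rw [Finset.sum_eq_single_of_mem k (Finset.mem_range.2 (Nat.lt_succ_of_le hk)) fun j _ hj => by
    rw [Function.update_of_ne hj, Finset.card_empty, Nat.cast_zero, mul_zero]]
  rw [Function.update_self, Finset.card_singleton, Nat.cast_one, mul_one]

/-- ★ **(SF) ⇒ MEAN FLATNESS AT EVERY SCALE** (the Jensen reading of module 15's display).  If the bare state `μ_β` (`β ≥ 0`) obeys (SF) up to level `K` with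
a per-level budget `a₀ > 0` and volume letter `c_V`, then for every `k ≤ K` and every level-`k` plaquette `p`,
`β·∫ (1 − reTr Ū^k(∂p)) dμ_β ≤ c_V` — i.e. `⟨1 − reTr Ū^k(∂p)⟩_β ≤ c_V·g₀²` when `β = g₀⁻²`.  In the regime this contradicts the calibration
`⟨1 − reTr Ū^k⟩ ≍ g_k²` with `g_K²∕g₀² ↑ ∞` (header (a)): a `K`-uniform `c_V` is a triviality statement for the unit-scale block field. [folklore] -/
theorem meanEnergy_le_of_scaleFactorised (P : Params) {β : ℝ} (hβ : 0 ≤ β) (K : ℕ) {a₀ cV : ℝ} (ha₀ : 0 < a₀)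
    (hSF : ∀ (Y : (k : ℕ) → Finset (Plaq P k)) (t : ℕ → ℝ), (∀ k, 0 ≤ t k) → (∀ k, t k ≤ a₀) →
      ∫ U, Real.exp (β * ∑ k ∈ Finset.range (K + 1), t k * ∑ p ∈ Y k, (1 - reTr (GaugeField.plaqHol
          (Averaging.iter (fun _ => BlockAveraging.blockAvg (ExpMeanLog.expMeanLogSU (n := Fin N))) k U) p)))
          ∂(T4GenFunBounds.gibbsMeasure P β : Measure (GaugeField P 0 (Matrix.specialUnitaryGroup (Fin N) ℂ))) ≤
        Real.exp (cV * ∑ k ∈ Finset.range (K + 1), t k * (Y k).card))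
    {k : ℕ} (hk : k ≤ K) (p : Plaq P k) :
    β * ∫ U, (1 - reTr (GaugeField.plaqHol
        (Averaging.iter (fun _ => BlockAveraging.blockAvg (ExpMeanLog.expMeanLogSU (n := Fin N))) k U) p))
        ∂(T4GenFunBounds.gibbsMeasure P β : Measure (GaugeField P 0 (Matrix.specialUnitaryGroup (Fin N) ℂ))) ≤ cV := by
  have h := hSF (Function.update (fun j : ℕ => (∅ : Finset (Plaq P j))) k ({p} : Finset (Plaq P k))) (fun _ => a₀)
    (fun _ => ha₀.le) fun _ => le_rfl
  simp_rw [levelsTilt_update_single P hk p (fun _ => a₀), card_update_single P hk p (fun _ => a₀)] at h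
  have hJ := meanEnergy_le_of_levelMoment (N := N) P hβ k p (β * a₀) (B := cV * a₀) (by simpa only [mul_assoc] using h)
  rw [mul_comm β a₀, mul_assoc, mul_comm cV a₀] at hJ
  exact le_of_mul_le_mul_left hJ ha₀

/-- ★ **(SF_w) ⇒ MEAN ENERGY IN RUNNING UNITS.**  If the bare state obeys the WEIGHTED display (SF_w) up to level `K` with profile `w`, budget `a₀ > 0` and
letter `c_V`, then for every `k ≤ K` and every level-`k` plaquette `p`, `(β·w_k)·∫ (1 − reTr Ū^k(∂p)) dμ_β ≤ c_V`; with `β w_k = g_k⁻²` this reads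
`⟨1 − reTr Ū^k(∂p)⟩ ≤ c_V·g_k²` — consistent with the calibration (header (b)). [folklore] -/
theorem meanEnergy_le_of_weightFactorised (P : Params) {β : ℝ} (hβ : 0 ≤ β) (K : ℕ) (w : ℕ → ℝ) {a₀ cV : ℝ} (ha₀ : 0 < a₀)
    (hSFw : ∀ (Y : (k : ℕ) → Finset (Plaq P k)) (s : ℕ → ℝ), (∀ k, 0 ≤ s k) → (∀ k, s k ≤ a₀) →
      ∫ U, Real.exp (β * ∑ k ∈ Finset.range (K + 1), (s k * w k) * ∑ p ∈ Y k, (1 - reTr (GaugeField.plaqHol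
          (Averaging.iter (fun _ => BlockAveraging.blockAvg (ExpMeanLog.expMeanLogSU (n := Fin N))) k U) p)))
          ∂(T4GenFunBounds.gibbsMeasure P β : Measure (GaugeField P 0 (Matrix.specialUnitaryGroup (Fin N) ℂ))) ≤
        Real.exp (cV * ∑ k ∈ Finset.range (K + 1), s k * (Y k).card))
    {k : ℕ} (hk : k ≤ K) (p : Plaq P k) :
    β * w k * ∫ U, (1 - reTr (GaugeField.plaqHol
        (Averaging.iter (fun _ => BlockAveraging.blockAvg (ExpMeanLog.expMeanLogSU (n := Fin N))) k U) p))
        ∂(T4GenFunBounds.gibbsMeasure P β : Measure (GaugeField P 0 (Matrix.specialUnitaryGroup (Fin N) ℂ))) ≤ cV := by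
  have h := hSFw (Function.update (fun j : ℕ => (∅ : Finset (Plaq P j))) k ({p} : Finset (Plaq P k))) (fun _ => a₀)
    (fun _ => ha₀.le) fun _ => le_rfl
  simp_rw [levelsTilt_update_single P hk p (fun j => a₀ * w j), card_update_single P hk p (fun _ => a₀)] at h
  have hJ := meanEnergy_le_of_levelMoment (N := N) P hβ k p (β * (a₀ * w k)) (B := cV * a₀) (by simpa only [mul_assoc] using h)
  have h' : a₀ * (β * w k * ∫ U, (1 - reTr (GaugeField.plaqHol
        (Averaging.iter (fun _ => BlockAveraging.blockAvg (ExpMeanLog.expMeanLogSU (n := Fin N))) k U) p))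
        ∂(T4GenFunBounds.gibbsMeasure P β : Measure (GaugeField P 0 (Matrix.specialUnitaryGroup (Fin N) ℂ)))) ≤ a₀ * cV := by
    calc _ = β * (a₀ * w k) * ∫ U, (1 - reTr (GaugeField.plaqHol
          (Averaging.iter (fun _ => BlockAveraging.blockAvg (ExpMeanLog.expMeanLogSU (n := Fin N))) k U) p))
          ∂(T4GenFunBounds.gibbsMeasure P β : Measure (GaugeField P 0 (Matrix.specialUnitaryGroup (Fin N) ℂ))) := by ring
      _ ≤ cV * a₀ := hJ
      _ = a₀ * cV := mul_comm _ _
  exact le_of_mul_le_mul_left h' ha₀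

end Jensen

/-! ## §2 The weighted display (SF_w): a weakening of (SF); ⇒ the product law ∕ (MSP) with factors `e^{c_V a₀}·e^{−a₀ (β w_k) ε_k}` -/

section WeightFactorised

variable {N : ℕ} [NeZero N]

/-- ★ **(SF) ⇒ (SF_w): THE REPAIR IS A WEAKENING.**  If (SF) holds up to level `K` with budget `a₀` and letter `c_V ≥ 0`, then (SF_w) holds for every profile
`0 ≤ w ≤ 1` with the same budget and letter (tilts `s_k w_k ≤ s_k ≤ a₀` are admissible in (SF); the volume exponent only grows). [folklore] -/
theorem weightFactorised_of_scaleFactorised (P : Params) (β : ℝ) (K : ℕ) {a₀ cV : ℝ} (hcV : 0 ≤ cV)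
    (hSF : ∀ (Y : (k : ℕ) → Finset (Plaq P k)) (t : ℕ → ℝ), (∀ k, 0 ≤ t k) → (∀ k, t k ≤ a₀) →
      ∫ U, Real.exp (β * ∑ k ∈ Finset.range (K + 1), t k * ∑ p ∈ Y k, (1 - reTr (GaugeField.plaqHol
          (Averaging.iter (fun _ => BlockAveraging.blockAvg (ExpMeanLog.expMeanLogSU (n := Fin N))) k U) p)))
          ∂(T4GenFunBounds.gibbsMeasure P β : Measure (GaugeField P 0 (Matrix.specialUnitaryGroup (Fin N) ℂ))) ≤
        Real.exp (cV * ∑ k ∈ Finset.range (K + 1), t k * (Y k).card))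
    {w : ℕ → ℝ} (hw0 : ∀ k, 0 ≤ w k) (hw1 : ∀ k, w k ≤ 1)
    (Y : (k : ℕ) → Finset (Plaq P k)) (s : ℕ → ℝ) (hs0 : ∀ k, 0 ≤ s k) (hsa : ∀ k, s k ≤ a₀) :
    ∫ U, Real.exp (β * ∑ k ∈ Finset.range (K + 1), (s k * w k) * ∑ p ∈ Y k, (1 - reTr (GaugeField.plaqHol
        (Averaging.iter (fun _ => BlockAveraging.blockAvg (ExpMeanLog.expMeanLogSU (n := Fin N))) k U) p)))
        ∂(T4GenFunBounds.gibbsMeasure P β : Measure (GaugeField P 0 (Matrix.specialUnitaryGroup (Fin N) ℂ))) ≤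
      Real.exp (cV * ∑ k ∈ Finset.range (K + 1), s k * (Y k).card) := by
  have h := hSF Y (fun k => s k * w k) (fun k => mul_nonneg (hs0 k) (hw0 k))
    fun k => (mul_le_of_le_one_right (hs0 k) (hw1 k)).trans (hsa k)
  refine h.trans (Real.exp_le_exp.2 (mul_le_mul_of_nonneg_left (Finset.sum_le_sum fun k _ => ?_) hcV))
  exact mul_le_mul_of_nonneg_right (mul_le_of_le_one_right (hs0 k) (hw1 k)) (Nat.cast_nonneg _)

/-- ★★★ **(SF_w) ⇒ THE PRODUCT LAW WITH ONE PEIERLS FACTOR `e^{c_V a₀}·e^{−a₀·(β w_k)·ε_k}` PER PINNED PLAQUETTE.**  If the bare state `μ_β` (`β ≥ 0`)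
obeys the weighted display (SF_w) up to level `K` with profile `w ≥ 0`, budget `a₀ ≥ 0` and letter `c_V`, then for all thresholds `ε_k` and families `Y`,
`μ_β{U | ∀ k ≤ K, ∀ p ∈ Y_k, ε_k ≤ 1 − reTr Ū^k(∂p)} ≤ Π_{k≤K} (e^{c_V a₀}·e^{−a₀·(β w_k)·ε_k})^{#Y_k}` — with `β w_k = g_k⁻²` and the record's energy
threshold `ε_k = g_k² p₀(g_k)²∕(2N B²)` the factor is `e^{c_V a₀}·e^{−a₀ p₀(g_k)²∕(2N B²)}`, print's rate shape. [folklore] -/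
theorem gibbsMeasure_multiLevel_largeField_le_prod_of_weightFactorised (P : Params) {β : ℝ} (hβ : 0 ≤ β) (K : ℕ)
    {w : ℕ → ℝ} (hw0 : ∀ k, 0 ≤ w k) {a₀ cV : ℝ} (ha₀ : 0 ≤ a₀)
    (hSFw : ∀ (Y : (k : ℕ) → Finset (Plaq P k)) (s : ℕ → ℝ), (∀ k, 0 ≤ s k) → (∀ k, s k ≤ a₀) →
      ∫ U, Real.exp (β * ∑ k ∈ Finset.range (K + 1), (s k * w k) * ∑ p ∈ Y k, (1 - reTr (GaugeField.plaqHol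
          (Averaging.iter (fun _ => BlockAveraging.blockAvg (ExpMeanLog.expMeanLogSU (n := Fin N))) k U) p)))
          ∂(T4GenFunBounds.gibbsMeasure P β : Measure (GaugeField P 0 (Matrix.specialUnitaryGroup (Fin N) ℂ))) ≤
        Real.exp (cV * ∑ k ∈ Finset.range (K + 1), s k * (Y k).card))
    (ε : ℕ → ℝ) (Y : (k : ℕ) → Finset (Plaq P k)) :
    (T4GenFunBounds.gibbsMeasure P β : Measure (GaugeField P 0 (Matrix.specialUnitaryGroup (Fin N) ℂ))).real
        {U | ∀ k ∈ Finset.range (K + 1), ∀ p ∈ Y k, ε k ≤ 1 - reTr (GaugeField.plaqHol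
          (Averaging.iter (fun _ => BlockAveraging.blockAvg (ExpMeanLog.expMeanLogSU (n := Fin N))) k U) p)} ≤
      ∏ k ∈ Finset.range (K + 1), (Real.exp (cV * a₀) * Real.exp (-(a₀ * (β * w k) * ε k))) ^ (Y k).card := by
  have hmain := measureReal_multiLevel_largeField_le_of_moment (N := N) P hβ K Y (t := fun k => a₀ * w k)
    (fun k => mul_nonneg ha₀ (hw0 k)) ε (hSFw Y (fun _ => a₀) (fun _ => ha₀) fun _ => le_rfl)
  refine hmain.trans (le_of_eq ?_)
  have h2 : Real.exp (cV * ∑ k ∈ Finset.range (K + 1), a₀ * ((Y k).card : ℝ)) =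
      ∏ k ∈ Finset.range (K + 1), Real.exp (cV * a₀) ^ (Y k).card := by
    rw [Finset.mul_sum, Real.exp_sum]
    exact Finset.prod_congr rfl fun k _ => by rw [← Real.exp_nat_mul]; ring_nf
  have h3 : Real.exp (-(β * ∑ k ∈ Finset.range (K + 1), a₀ * w k * ε k * (Y k).card)) =
      ∏ k ∈ Finset.range (K + 1), Real.exp (-(a₀ * (β * w k) * ε k)) ^ (Y k).card := by
    rw [Finset.mul_sum, ← Finset.sum_neg_distrib, Real.exp_sum]
    exact Finset.prod_congr rfl fun k _ => by rw [← Real.exp_nat_mul]; ring_nf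
  rw [h2, h3, ← Finset.prod_mul_distrib]
  exact Finset.prod_congr rfl fun k _ => by rw [mul_pow]

/-- ★★ **THE SAME IN THE SIZE CURRENCY** (`ε_k ≤ |Ū^k(∂p) − 1|`, `ε_k ≥ 0`): under (SF_w) up to level `K`,
`μ_β{U | ∀ k ≤ K, ∀ p ∈ Y_k, ε_k ≤ |Ū^k U(∂p) − 1|} ≤ Π_{k≤K} (e^{c_V a₀}·e^{−a₀·(β w_k)·ε_k²∕(2N)})^{#Y_k}`. [folklore] -/
theorem gibbsMeasure_multiLevel_largeField_dist1_le_prod_of_weightFactorised (P : Params) {β : ℝ} (hβ : 0 ≤ β) (K : ℕ)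
    {w : ℕ → ℝ} (hw0 : ∀ k, 0 ≤ w k) {a₀ cV : ℝ} (ha₀ : 0 ≤ a₀)
    (hSFw : ∀ (Y : (k : ℕ) → Finset (Plaq P k)) (s : ℕ → ℝ), (∀ k, 0 ≤ s k) → (∀ k, s k ≤ a₀) →
      ∫ U, Real.exp (β * ∑ k ∈ Finset.range (K + 1), (s k * w k) * ∑ p ∈ Y k, (1 - reTr (GaugeField.plaqHol
          (Averaging.iter (fun _ => BlockAveraging.blockAvg (ExpMeanLog.expMeanLogSU (n := Fin N))) k U) p)))
          ∂(T4GenFunBounds.gibbsMeasure P β : Measure (GaugeField P 0 (Matrix.specialUnitaryGroup (Fin N) ℂ))) ≤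
        Real.exp (cV * ∑ k ∈ Finset.range (K + 1), s k * (Y k).card))
    {ε : ℕ → ℝ} (hε : ∀ k, 0 ≤ ε k) (Y : (k : ℕ) → Finset (Plaq P k)) :
    (T4GenFunBounds.gibbsMeasure P β : Measure (GaugeField P 0 (Matrix.specialUnitaryGroup (Fin N) ℂ))).real
        {U | ∀ k ∈ Finset.range (K + 1), ∀ p ∈ Y k, ε k ≤ dist1 (GaugeField.plaqHol
          (Averaging.iter (fun _ => BlockAveraging.blockAvg (ExpMeanLog.expMeanLogSU (n := Fin N))) k U) p)} ≤
      ∏ k ∈ Finset.range (K + 1),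
        (Real.exp (cV * a₀) * Real.exp (-(a₀ * (β * w k) * (ε k ^ 2 / (2 * (Fintype.card (Fin N) : ℝ)))))) ^ (Y k).card := by
  haveI := T4GenFunBounds.isProbabilityMeasure_gibbsMeasure (G := Matrix.specialUnitaryGroup (Fin N) ℂ) P hβ
  have hsub : {U : GaugeField P 0 (Matrix.specialUnitaryGroup (Fin N) ℂ) | ∀ k ∈ Finset.range (K + 1), ∀ p ∈ Y k,
        ε k ≤ dist1 (GaugeField.plaqHol
          (Averaging.iter (fun _ => BlockAveraging.blockAvg (ExpMeanLog.expMeanLogSU (n := Fin N))) k U) p)} ⊆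
      {U | ∀ k ∈ Finset.range (K + 1), ∀ p ∈ Y k, ε k ^ 2 / (2 * (Fintype.card (Fin N) : ℝ)) ≤
        1 - reTr (GaugeField.plaqHol
          (Averaging.iter (fun _ => BlockAveraging.blockAvg (ExpMeanLog.expMeanLogSU (n := Fin N))) k U) p)} :=
    fun U hU k hk p hp => sq_div_le_one_sub_reTr_of_le_dist1 _ (hε k) (hU k hk p hp)
  exact (measureReal_mono hsub (measure_ne_top _ _)).trans
    (gibbsMeasure_multiLevel_largeField_le_prod_of_weightFactorised P hβ K hw0 ha₀ hSFw
      (fun k => ε k ^ 2 / (2 * (Fintype.card (Fin N) : ℝ))) Y)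

/-- ★★★ **(SF_w) ⇒ (MSP) ON THE BARE FIELD — CELLS AT EVERY LEVEL.**  Under (SF_w) up to level `K` (profile `w ≥ 0`, budget `a₀ ≥ 0`, letter `c_V`), for
thresholds `ε_k ≥ 0` and every finite family of pins `c ∈ 𝒞` with levels `ℓ c ≤ K`, witness sets of size `≤ m_{ℓ c}` pairwise disjoint inside `Σ k, Plaq P k`:
`μ_β{U | ∀ c ∈ 𝒞, ∃ p ∈ cells c, ε_{ℓ c} ≤ |Ū^{ℓ c}U(∂p) − 1|} ≤ Π_{c∈𝒞} m_{ℓ c}·(e^{c_V a₀}·e^{−a₀·(β w_{ℓ c})·ε_{ℓ c}²∕(2N)})`. [folklore] -/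
theorem gibbsMeasure_multiLevel_largeFieldCells_le_prod_of_weightFactorised (P : Params) {β : ℝ} (hβ : 0 ≤ β) (K : ℕ)
    {w : ℕ → ℝ} (hw0 : ∀ k, 0 ≤ w k) {a₀ cV : ℝ} (ha₀ : 0 ≤ a₀)
    (hSFw : ∀ (Y : (k : ℕ) → Finset (Plaq P k)) (s : ℕ → ℝ), (∀ k, 0 ≤ s k) → (∀ k, s k ≤ a₀) →
      ∫ U, Real.exp (β * ∑ k ∈ Finset.range (K + 1), (s k * w k) * ∑ p ∈ Y k, (1 - reTr (GaugeField.plaqHol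
          (Averaging.iter (fun _ => BlockAveraging.blockAvg (ExpMeanLog.expMeanLogSU (n := Fin N))) k U) p)))
          ∂(T4GenFunBounds.gibbsMeasure P β : Measure (GaugeField P 0 (Matrix.specialUnitaryGroup (Fin N) ℂ))) ≤
        Real.exp (cV * ∑ k ∈ Finset.range (K + 1), s k * (Y k).card))
    {ε : ℕ → ℝ} (hε : ∀ k, 0 ≤ ε k)
    {κ : Type*} (𝒞 : Finset κ) (ℓ : κ → ℕ) (cells : (c : κ) → Finset (Plaq P (ℓ c))) (m : ℕ → ℕ)
    (hℓ : ∀ c ∈ 𝒞, ℓ c ≤ K) (hm : ∀ c ∈ 𝒞, (cells c).card ≤ m (ℓ c))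
    (hdisj : ∀ c₁ ∈ 𝒞, ∀ c₂ ∈ 𝒞, c₁ ≠ c₂ →
      Disjoint ((cells c₁).map (Function.Embedding.sigmaMk (β := fun k => Plaq P k) (ℓ c₁)))
        ((cells c₂).map (Function.Embedding.sigmaMk (β := fun k => Plaq P k) (ℓ c₂)))) :
    (T4GenFunBounds.gibbsMeasure P β : Measure (GaugeField P 0 (Matrix.specialUnitaryGroup (Fin N) ℂ))).real
        {U | ∀ c ∈ 𝒞, ∃ p ∈ cells c, ε (ℓ c) ≤ dist1 (GaugeField.plaqHol
          (Averaging.iter (fun _ => BlockAveraging.blockAvg (ExpMeanLog.expMeanLogSU (n := Fin N))) (ℓ c) U) p)} ≤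
      ∏ c ∈ 𝒞, ((m (ℓ c) : ℝ) *
        (Real.exp (cV * a₀) * Real.exp (-(a₀ * (β * w (ℓ c)) * (ε (ℓ c) ^ 2 / (2 * (Fintype.card (Fin N) : ℝ))))))) := by
  haveI := T4GenFunBounds.isProbabilityMeasure_gibbsMeasure (G := Matrix.specialUnitaryGroup (Fin N) ℂ) P hβ
  exact measureReal_largeFieldCells_le_of_levels P _ K ε
    (fun k => Real.exp (cV * a₀) * Real.exp (-(a₀ * (β * w k) * (ε k ^ 2 / (2 * (Fintype.card (Fin N) : ℝ))))))
    (fun k => by positivity)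
    (fun Y => gibbsMeasure_multiLevel_largeField_dist1_le_prod_of_weightFactorised P hβ K hw0 ha₀ hSFw hε Y) 𝒞 ℓ cells m hℓ hm hdisj

end WeightFactorised

/-! ## §3 (SF_w) ⇒ the class-weight product on Bałaban's label tower, with the weight profile -/

section LabelTower

variable (F : T4Family) (N : ℕ) [NeZero N] (ν : Stage7Numerics) (M : ℕ) (p : B12.RunParams) (g : ℕ → ℝ)

open Classical in
/-- ★★★ **(SF_w) ⇒ (MSP) ⇒ THE CLASS WEIGHT IS THE FULL PRODUCT, ONE FACTOR `m_j·e^{c_V a₀}·e^{−a₀·(g₀⁻² w_{j+1})·ε_j²∕(2N)}` PER PINNED CUBE** (module 15 §3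
with the weight profile; the located wall of NE7b in the fourth currency in its correctly calibrated MOMENT form).  IF the Wilson–Gibbs measure of the bare
field at `β = g₀⁻²` obeys (SF_w) up to level `K_P` with profile `w ≥ 0` (in the application `w_k = g₀²∕g_k²`, so `g₀⁻² w_k = g_k⁻²`), budget `a₀ ≥ 0` and
letter `c_V` — NOT in the tree, NOT printed as a statement; print's KIND [Balaban1989LargeFieldII] (1.79) — THEN for every `E₀`, `A₁`, every `ζ` obeying the
two laws with (O4)-measurable label weights, every finite set `J` of pinned levels `j < K_P`, families `D j` with regularity letters on pairwise disjoint
regions `R j c` of `≤ m_j` level-`(j+1)` plaquettes, thresholds `ε_j ≥ 0`, every cutoff `K′` and every label-family pattern pinning `D j` at `j ∈ J`, free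
elsewhere, `Σ_{h ∈ admS (labelTowerOfRecord A₁ ζ) (labelPattern E) K′} ∫ eterm ρ₀ K′ h dμ_{K′} ≤
   (Π_{j∈J, j<K′} (m_j·(e^{c_V a₀}·e^{−a₀·(g₀⁻² w_{j+1})·ε_j²∕(2N)}))^{#D_j}) · ∫ ρ₀ dU₀`. [folklore] -/
theorem sum_admS_integral_le_labelTower_prod_of_weightFactorised (g₀ E₀ A₁ : ℝ) {w : ℕ → ℝ} (hw0 : ∀ k, 0 ≤ w k)
    {a₀ cV : ℝ} (ha₀ : 0 ≤ a₀)
    (hSFw : ∀ (Y : (k : ℕ) → Finset (Plaq (F.P p.K) k)) (s : ℕ → ℝ), (∀ k, 0 ≤ s k) → (∀ k, s k ≤ a₀) →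
      ∫ U, Real.exp (g₀⁻¹ ^ 2 * ∑ k ∈ Finset.range (p.K + 1), (s k * w k) * ∑ q ∈ Y k, (1 - reTr (GaugeField.plaqHol
          (Averaging.iter (fun _ => BlockAveraging.blockAvg (ExpMeanLog.expMeanLogSU (n := Fin N))) k U) q)))
          ∂(T4GenFunBounds.gibbsMeasure (F.P p.K) (g₀⁻¹ ^ 2) : Measure (cfgOfRecord F N p.K 0)) ≤
        Real.exp (cV * ∑ k ∈ Finset.range (p.K + 1), s k * (Y k).card))
    {ζ : ZetaOfRecord F N ν M} (hζu : IsZetaUnity F N ν M ζ) (hζ : IsZetaAbsLeOne F N ν M ζ)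
    (hω : ∀ (k : ℕ) (s : SeqOfRecord F ν M g p.K k) (t : LbOfRecord F ν p g k),
      Measurable fun z : cfgOfRecord F N p.K (k + 1) × cfgOfRecord F N p.K k => ωOfRecord F N ν M p g k A₁ ζ s t z.2 z.1)
    (J : Finset ℕ) (hJK : ∀ j ∈ J, j < p.K)
    (D : (j : ℕ) → Finset (Iχ F ν p g j)) (R : (j : ℕ) → Iχ F ν p g j → Finset (Plaq (F.P p.K) (j + 1))) (m : ℕ → ℕ) (ε : ℕ → ℝ)
    (hε : ∀ j ∈ J, 0 ≤ ε j) (hm : ∀ j ∈ J, ∀ c ∈ D j, (R j c).card ≤ m j)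
    (hdisj : ∀ j ∈ J, ∀ c₁ ∈ D j, ∀ c₂ ∈ D j, c₁ ≠ c₂ → Disjoint (R j c₁) (R j c₂))
    (hreg : ∀ j ∈ J, ∀ c ∈ D j, ∀ V' : GaugeField (F.P p.K) (j + 1) (SU N),
      (∀ p' ∈ R j c, dist1 (GaugeField.plaqHol V' p') < ε j) → chiFactor F N ν p g j c V' = 1)
    (K' : ℕ) (E : (j : ℕ) → (Fin j → LabelPat F ν p g) → Finset (LbOfRecord F ν p g j))
    (hEpin : ∀ j ∈ J, ∀ h t, t ∈ E j h → D j ⊆ t.1) (hEfree : ∀ j, j ∉ J → ∀ h, E j h = Finset.univ) :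
    ∑ h ∈ admS (labelTowerOfRecord F N ν M p g A₁ ζ) (labelPattern F ν p g E) K',
        ∫ x, (labelTowerOfRecord F N ν M p g A₁ ζ).eterm (rhoZeroOfRecord F N p.K g₀ E₀) K' h x ∂(lawOfRecord F N p.K K') ≤
      (∏ j ∈ J.filter (· < K'), ((m j : ℝ) * (Real.exp (cV * a₀) *
          Real.exp (-(a₀ * (g₀⁻¹ ^ 2 * w (j + 1)) * (ε j ^ 2 / (2 * (Fintype.card (Fin N) : ℝ))))))) ^ (D j).card) *
        ∫ U, rhoZeroOfRecord F N p.K g₀ E₀ U ∂(fieldMeasure (F.P p.K) 0 (SU N)) := by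
  have key := sum_admS_integral_labelTower_le_gibbsReal_mul F N ν M p g g₀ E₀ A₁ hζu hζ hω J D R ε hreg E hEpin hEfree K'
  refine key.trans (mul_le_mul_of_nonneg_right ?_ (integral_nonneg fun U => (rhoZeroOfRecord_pos F N p.K g₀ E₀ U).le))
  have hβ0 : (0 : ℝ) ≤ g₀⁻¹ ^ 2 := sq_nonneg _
  haveI := T4GenFunBounds.isProbabilityMeasure_gibbsMeasure (G := SU N) (F.P p.K) hβ0
  -- the pins `(j, c)`, `j ∈ J`, `j < K′`, `c ∈ D j`, at level `j + 1`; thresholds re-indexed by level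
  set 𝒞 : Finset (Σ j, Iχ F ν p g j) := (J.filter (· < K')).sigma D with h𝒞
  set ε' : ℕ → ℝ := fun k => max 0 (ε (k - 1)) with hε'
  have hε'0 : ∀ k, 0 ≤ ε' k := fun k => le_max_left _ _
  have hε'J : ∀ j ∈ J, ε' (j + 1) = ε j := fun j hj => by
    rw [hε']; simp only [Nat.add_sub_cancel]; exact max_eq_right (hε j hj)
  have hmem𝒞 : ∀ x ∈ 𝒞, x.1 ∈ J ∧ x.1 < K' ∧ x.2 ∈ D x.1 := fun x hx => by
    rw [h𝒞, Finset.mem_sigma, Finset.mem_filter] at hx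
    exact ⟨hx.1.1, hx.1.2, hx.2⟩
  have hcells := gibbsMeasure_multiLevel_largeFieldCells_le_prod_of_weightFactorised (N := N) (F.P p.K) hβ0 p.K hw0 ha₀ hSFw hε'0 𝒞
    (fun x => x.1 + 1) (fun x => R x.1 x.2) (fun k => m (k - 1))
    (fun x hx => Nat.succ_le_of_lt (hJK x.1 (hmem𝒞 x hx).1))
    (fun x hx => by simpa only [Nat.add_sub_cancel] using hm x.1 (hmem𝒞 x hx).1 x.2 (hmem𝒞 x hx).2.2)
    (fun x₁ hx₁ x₂ hx₂ hne => ?_)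
  · have hsub : {U : cfgOfRecord F N p.K 0 | ∀ j ∈ J, j < K' → ∀ c ∈ D j, ∃ p' ∈ R j c,
          ε j ≤ dist1 (GaugeField.plaqHol (iterMap (fun i => (avOfRecord F N p.K i).avg) (j + 1) U) p')} ⊆
        {U | ∀ x ∈ 𝒞, ∃ p' ∈ R x.1 x.2, ε' (x.1 + 1) ≤ dist1 (GaugeField.plaqHol
          (Averaging.iter (fun _ => BlockAveraging.blockAvg (ExpMeanLog.expMeanLogSU (n := Fin N))) (x.1 + 1) U) p')} := by
      intro U hU x hx
      obtain ⟨hj, hjK, hc⟩ := hmem𝒞 x hx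
      obtain ⟨p', hp', hle⟩ := hU x.1 hj hjK x.2 hc
      refine ⟨p', hp', ?_⟩
      rw [hε'J x.1 hj, ← iterMap_avOfRecord_eq]
      exact hle
    refine (measureReal_mono hsub (measure_ne_top _ _)).trans (hcells.trans (le_of_eq ?_))
    rw [h𝒞, Finset.prod_sigma]
    refine Finset.prod_congr rfl fun j hj => ?_
    have hjJ : j ∈ J := (Finset.mem_filter.mp hj).1
    simp only [Finset.prod_const, Nat.add_sub_cancel, hε'J j hjJ]
  · obtain ⟨j₁, c₁⟩ := x₁
    obtain ⟨j₂, c₂⟩ := x₂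
    obtain ⟨hj₁, -, hc₁⟩ := hmem𝒞 _ hx₁
    obtain ⟨-, -, hc₂⟩ := hmem𝒞 _ hx₂
    by_cases hj : j₁ = j₂
    · subst hj
      have hne' : c₁ ≠ c₂ := fun hc => hne (by rw [hc])
      exact (Finset.disjoint_map _).mpr (hdisj j₁ hj₁ c₁ hc₁ c₂ hc₂ hne')
    · refine Finset.disjoint_left.mpr fun q hq₁ hq₂ => hj ?_
      obtain ⟨p₁, -, rfl⟩ := Finset.mem_map.mp hq₁
      obtain ⟨p₂, -, hq⟩ := Finset.mem_map.mp hq₂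
      have := congrArg Sigma.fst hq
      simp only [Function.Embedding.sigmaMk_apply] at this
      omega

end LabelTower

end Summit.QuantumFields.YangMills.BalabanUVNodes.N20ByValueMultiscaleWallRunning
/-! ## Erratum to the header prose (v1.1, append-only; no declaration changed): (SF_w) HAS NO `K`-UNIFORM LETTER EITHER — the moment road stays closed; module 15 v1.1 (3) stands
(b)'s proviso «as long as `K·log L ≪ L^{4∕a₀}`» IS a `K`-non-uniformity of the letter of module 15 v1.1 (2), inside the regime and at a FIXED scale (one loop, desk): an `O(1)`-action flux lump of extent
= magnetic length `L^{n⋆}`, `n⋆ + 1 = ⌈2c₁∕a₀⌉` (`c₁ = O(1)` its cost coefficient, `μ_β(lump) ≍ e^{−c₁ g_{n⋆}⁻² E₀}`; every level `k ≤ n⋆` sees the same energy `E₀`, d = 4), is tilted by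
`a₀E₀·Σ_{k≤n⋆} g_k⁻² ≥ 2c₁E₀·g_{n⋆}⁻²` against the region letter `6.4·c_V a₀·L^{4n⋆}`, so (SF_w) forces `c_V ≥ c₁E₀·g_{n⋆}⁻²∕(6.4 a₀ L^{4n⋆})`, and `g_{n⋆} → g₀` at fixed `n⋆` as `K → ∞`:
`c_V(K) ≳ (c₁E₀∕(6.4a₀))·L^{−4n⋆}·β`, LINEAR IN `β = g₀⁻² ≍ K·log L` with slope `L^{−4n⋆}∕a₀` (≈ 2.6·10⁻¹⁴ at `a₀ = 1∕12`, `c₁ = E₀ = ½`, `L = 2`) where (SF)'s slope is `g²` (§1). Hence §2's factor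
`e^{c_V(K)a₀}` outgrows `e^{−a₀p₀(g_k)²∕(2NB²)}` (polylog in `K`): (SF_w) CANNOT deliver `Σ_K W_K < ∞` — a display for towers of height `K·log L ≲ L^{4n⋆}`, NOT a socket for NE7b, whose regime IS
`K → ∞`. No weight profile cures this (a scale-`n` lump is charged once PER LEVEL against ONE cost, so uniformity at the UV scales `n ≲ ¼·log_L β` needs a SUMMABLE modulation `βw_k = θ_k g_k⁻²`,
`Σ_k θ_k ≤ c₁∕a₀`, whose delivered exponents `a₀θ_k p₀(g_k)²∕(2NB²)` SUM over the whole tower to `≤ c₁·p₀(g₀)²∕(2NB²)` — a bounded total where NE7b needs one unit per pinned level; module 13's `τ_k` is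
such a profile). The `K`-uniform by-value socket of NE7b is the EVENT law (MSP) alone (module 11 §3 ∕ module 15 §1; print's per-cube kind, [Balaban1989LargeFieldII] (1.85) p. 386); «CORRECTED READING»
above is so amended; trigger (t4) reverts to «an (MSP)-type ∕ history-conditional supplier» (g12). Count-neutral; nothing of Bałaban's asserted; NE7b NOT PROVED. -/
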